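import Summits.AtomisticToContinuum.Crystallization.Theses.ExcessDecayLiouville
import Literature.MathematicalPhysics.StatisticalMechanics.LennardJonesClusters

/-!
# `CoarseGrains` / Negative: the crux's predicates unbundled — admissible hcp data are Delone two-lattices

Negative-knowledge API for crux `stmt-AtomisticToContinuum-9331` (`ExcessDecayLiouville.CoarseGrains`:
every large Lennard-Jones ground state contains, for every `R`, a ball `B_R(c)` two-way `1/40`-matched with
an admissible affine hcp two-lattice), standing crux-disprover seat
`refuter-cdisprove-stmt-AtomisticToContinuum-9331-0` (2026-08-16).  Nothing here closes an item and no
theorem concludes a Theses decl; the sibling files `Negative.LoadBearing` (minimality and largeness are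
load-bearing; no `N₀` uniform in `R`) and `Negative.RadiusVacuity` (`R < 97/200` is vacuous) build on it,
and the crux work file `Cruxes/CoarseGrains/Disproof.lean` carries the prose analysis of why the crux
resists (crystallization-strength, BlancLewin2015 §2.3).

* `Lam` / `Near` / `Adm` / `Inner` are VERBATIM the `let`-bound sub-expressions of the crux;
  `coarseGrains_iff` is `Iff.rfl`.
* `adm_le_norm` / `adm_norm_le` (`189/200 ≤ ‖A w‖/‖w‖ ≤ 199/200`), `adm_injective`, `adm_surjective`;
* `one_le_norm_of_mem_lam` (`Λ ∖ 0` has norm `≥ 1`), `exists_lam_near` (covering radius of `Λ` `≤ 11/10`);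
* `exists_site_near` (every point of `ℝ³` is within `11/10` of a site of ANY admissible datum),
  `le_dist_site_of_ne` (same sublattice: sites `≥ 189/200` apart), `le_dist_site_cross` (different
  sublattices: `≥ 7/10` apart, uses `Inner`), `site_eq_of_dist_lt` (two sites within `1/40` of one point
  coincide — at tolerance `1/40` the matching never merges sites; contrast the refuted unseparated
  gluing stmt-3506).
-/

noncomputable section

open Literature.MathematicalPhysics.StatisticalMechanics

namespace Summit.AtomisticToContinuum.Crystallization.Theorems.CoarseGrains.Negative.PredicateAPI

/-- `ℝ³`. -/
abbrev E3 := EuclideanSpace ℝ (Fin 3)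

/-- The period lattice `Λ = ℤu + ℤv + ℤ·2√(2/3)e₃` of the unit hcp stacking (verbatim from the crux). -/
def Lam : Set E3 := {z | ∃ i j k : ℤ, z = (i : ℝ) • triangularVec₁ 1 + (j : ℝ) • triangularVec₂ 1 +
  (k : ℝ) • layerNormal (2 * Real.sqrt (2 / 3))}

/-- Two-way `ε`-matching of `X` with the sites `t m + A z` on the closed ball `B_r(c)` (verbatim). -/
def Near (X : Set E3) (c : E3) (r : ℝ) (t : Fin 2 → E3) (A : E3 →L[ℝ] E3) (ε : ℝ) : Prop :=
  (∀ p ∈ X, dist p c ≤ r → ∃ m : Fin 2, ∃ z ∈ Lam, dist p (t m + A z) ≤ ε) ∧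
  (∀ m : Fin 2, ∀ z ∈ Lam, dist (t m + A z) c ≤ r → ∃ p ∈ X, dist p (t m + A z) ≤ ε)

/-- Admissible cell: within `1/40` (operator norm) of `0.97·O`, `O` a linear isometry (verbatim). -/
def Adm (A : E3 →L[ℝ] E3) : Prop :=
  ∃ R : E3 ≃ₗᵢ[ℝ] E3, ‖A - (97 / 100 : ℝ) • (R.toContinuousLinearEquiv : E3 →L[ℝ] E3)‖ ≤ 1 / 40

/-- hcp-like inner displacement of the two sublattices (verbatim). -/
def Inner (t : Fin 2 → E3) (A : E3 →L[ℝ] E3) : Prop :=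
  ‖t 1 - t 0 - A (barlowOffset 1 + layerNormal (Real.sqrt (2 / 3)))‖ ≤ 1 / 40

/-! ### Coordinates and norms in `ℝ³` -/

/-- A coordinate squared is at most the norm squared. [folklore] -/
theorem sq_apply_le_norm_sq (w : E3) (l : Fin 3) : w l ^ 2 ≤ ‖w‖ ^ 2 := by
  have norm_sq_eq : ‖w‖ ^ 2 = w 0 ^ 2 + w 1 ^ 2 + w 2 ^ 2 := by
    rw [EuclideanSpace.norm_eq, Real.sq_sqrt (by positivity), Fin.sum_univ_three]
    simp [Real.norm_eq_abs, sq_abs]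
  rw [norm_sq_eq]
  fin_cases l
  · simp only [Fin.zero_eta]; nlinarith [sq_nonneg (w 1), sq_nonneg (w 2)]
  · simp only [Fin.mk_one]; nlinarith [sq_nonneg (w 0), sq_nonneg (w 2)]
  · simp only [Fin.reduceFinMk]; nlinarith [sq_nonneg (w 0), sq_nonneg (w 1)]

/-- `|w l| ≤ ‖w‖` for each coordinate. [folklore] -/
theorem abs_apply_le_norm (w : E3) (l : Fin 3) : |w l| ≤ ‖w‖ :=
  abs_le_of_sq_le_sq' (sq_apply_le_norm_sq w l) (norm_nonneg w) |> fun h' => abs_le.2 h'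

/-- Coordinates of a `Lam`-combination. -/
theorem lamVec_apply (i j k : ℝ) :
    (i • triangularVec₁ 1 + j • triangularVec₂ 1 + k • layerNormal (2 * Real.sqrt (2 / 3)) : E3) 0
      = i + j / 2 ∧
    (i • triangularVec₁ 1 + j • triangularVec₂ 1 + k • layerNormal (2 * Real.sqrt (2 / 3)) : E3) 1
      = j * (Real.sqrt 3 / 2) ∧
    (i • triangularVec₁ 1 + j • triangularVec₂ 1 + k • layerNormal (2 * Real.sqrt (2 / 3)) : E3) 2
      = k * (2 * Real.sqrt (2 / 3)) := by
  refine ⟨?_, ?_, ?_⟩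
  · simp [triangularVec₁, triangularVec₂, layerNormal]; ring
  · simp [triangularVec₁, triangularVec₂, layerNormal]
  · simp [triangularVec₁, triangularVec₂, layerNormal]

/-- `‖u‖ = 1` for `u = triangularVec₁ 1 = (1,0,0)`. [folklore] -/
theorem norm_triangularVec₁ : ‖(triangularVec₁ 1 : E3)‖ = 1 := by
  rw [EuclideanSpace.norm_eq, Fin.sum_univ_three]
  simp [triangularVec₁]


/-! ### Admissible cells are bi-Lipschitz (`189/200 ≤ ‖A w‖/‖w‖ ≤ 199/200`) and onto -/

/-- Unbundled `Adm`: `‖A w − 0.97·O w‖ ≤ ‖w‖/40` for the witnessing isometry `O`. [folklore] -/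
theorem adm_norm_sub_le {A : E3 →L[ℝ] E3} (hA : Adm A) :
    ∃ R : E3 ≃ₗᵢ[ℝ] E3, ∀ w : E3, ‖A w - (97 / 100 : ℝ) • R w‖ ≤ (1 / 40) * ‖w‖ := by
  obtain ⟨R, hR⟩ := hA
  refine ⟨R, fun w => ?_⟩
  have h := (A - (97 / 100 : ℝ) • (R.toContinuousLinearEquiv : E3 →L[ℝ] E3)).le_opNorm w
  have h' : (A - (97 / 100 : ℝ) • (R.toContinuousLinearEquiv : E3 →L[ℝ] E3)) w
      = A w - (97 / 100 : ℝ) • R w := by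
    simp
  rw [h'] at h
  exact h.trans (mul_le_mul_of_nonneg_right hR (norm_nonneg w))

/-- An admissible cell expands norms by at most `199/200`. [folklore] -/
theorem adm_norm_le {A : E3 →L[ℝ] E3} (hA : Adm A) (w : E3) : ‖A w‖ ≤ (199 / 200) * ‖w‖ := by
  obtain ⟨R, hR⟩ := adm_norm_sub_le hA
  have h1 := hR w
  have h2 : ‖(97 / 100 : ℝ) • R w‖ = (97 / 100) * ‖w‖ := by
    rw [norm_smul, LinearIsometryEquiv.norm_map]; norm_num
  calc ‖A w‖ = ‖(A w - (97 / 100 : ℝ) • R w) + (97 / 100 : ℝ) • R w‖ := by rw [sub_add_cancel]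
    _ ≤ ‖A w - (97 / 100 : ℝ) • R w‖ + ‖(97 / 100 : ℝ) • R w‖ := norm_add_le _ _
    _ ≤ (1 / 40) * ‖w‖ + (97 / 100) * ‖w‖ := by rw [h2]; linarith
    _ = (199 / 200) * ‖w‖ := by ring

/-- An admissible cell shrinks norms by at most `189/200`. [folklore] -/
theorem adm_le_norm {A : E3 →L[ℝ] E3} (hA : Adm A) (w : E3) : (189 / 200) * ‖w‖ ≤ ‖A w‖ := by
  obtain ⟨R, hR⟩ := adm_norm_sub_le hA
  have h1 := hR w
  have h2 : ‖(97 / 100 : ℝ) • R w‖ = (97 / 100) * ‖w‖ := by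
    rw [norm_smul, LinearIsometryEquiv.norm_map]; norm_num
  have h3 : ‖(97 / 100 : ℝ) • R w‖ ≤ ‖A w‖ + ‖A w - (97 / 100 : ℝ) • R w‖ := by
    calc ‖(97 / 100 : ℝ) • R w‖ = ‖A w - (A w - (97 / 100 : ℝ) • R w)‖ := by rw [sub_sub_cancel]
      _ ≤ ‖A w‖ + ‖A w - (97 / 100 : ℝ) • R w‖ := norm_sub_le _ _
  linarith

/-- An admissible cell is injective. [folklore] -/
theorem adm_injective {A : E3 →L[ℝ] E3} (hA : Adm A) : Function.Injective A := by
  refine (injective_iff_map_eq_zero A).2 fun w hw => ?_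
  have h := adm_le_norm hA w
  rw [hw, norm_zero] at h
  have : ‖w‖ ≤ 0 := by linarith [norm_nonneg w]
  exact norm_le_zero_iff.1 this

/-- An admissible cell is onto (injective endomorphism of `ℝ³`). [folklore] -/
theorem adm_surjective {A : E3 →L[ℝ] E3} (hA : Adm A) : Function.Surjective A := by
  have h : Function.Injective (A : E3 →ₗ[ℝ] E3) := adm_injective hA
  exact LinearMap.injective_iff_surjective.1 h

/-! ### The period lattice `Λ`: closure, separation (`‖z‖ ≥ 1` on `Λ ∖ 0`), covering radius `≤ 11/10` -/

/-- Integer combinations of the generators lie in `Λ`. [folklore] -/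
theorem mem_lam (i j k : ℤ) :
    ((i : ℝ) • triangularVec₁ 1 + (j : ℝ) • triangularVec₂ 1 +
      (k : ℝ) • layerNormal (2 * Real.sqrt (2 / 3)) : E3) ∈ Lam := ⟨i, j, k, rfl⟩

/-- `u ∈ Λ`. [folklore] -/
theorem triangularVec₁_mem_lam : (triangularVec₁ 1 : E3) ∈ Lam :=
  ⟨1, 0, 0, by simp⟩

/-- `0 ∈ Λ`. [folklore] -/
theorem zero_mem_lam : (0 : E3) ∈ Lam := ⟨0, 0, 0, by simp⟩

/-- `Λ` is closed under addition. [folklore] -/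
theorem lam_add_mem {z z' : E3} (hz : z ∈ Lam) (hz' : z' ∈ Lam) : z + z' ∈ Lam := by
  obtain ⟨i, j, k, rfl⟩ := hz
  obtain ⟨i', j', k', rfl⟩ := hz'
  refine ⟨i + i', j + j', k + k', ?_⟩
  push_cast
  simp only [add_smul]
  abel

/-- `Λ` is closed under negation. [folklore] -/
theorem lam_neg_mem {z : E3} (hz : z ∈ Lam) : -z ∈ Lam := by
  obtain ⟨i, j, k, rfl⟩ := hz
  refine ⟨-i, -j, -k, ?_⟩
  push_cast
  simp only [neg_smul]
  abel

/-- `Λ` is closed under subtraction. [folklore] -/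
theorem lam_sub_mem {z z' : E3} (hz : z ∈ Lam) (hz' : z' ∈ Lam) : z - z' ∈ Lam := by
  simpa [sub_eq_add_neg] using lam_add_mem hz (lam_neg_mem hz')

/-- `Λ` is closed under natural multiples. [folklore] -/
theorem lam_nsmul_mem (n : ℕ) {z : E3} (hz : z ∈ Lam) : (n : ℝ) • z ∈ Lam := by
  induction n with
  | zero => simpa using zero_mem_lam
  | succ n ih =>
    have : ((n + 1 : ℕ) : ℝ) • z = (n : ℝ) • z + z := by push_cast; rw [add_smul, one_smul]
    rw [this]; exact lam_add_mem ih hz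

/-- `(√(2/3))² = 2/3`. [folklore] -/
theorem sqrt23_sq : Real.sqrt (2 / 3) ^ 2 = 2 / 3 := Real.sq_sqrt (by norm_num)

/-- `‖i u + j v + k·2√(2/3)e₃‖² = (i + j/2)² + 3j²/4 + 8k²/3`. [folklore] -/
theorem lam_norm_sq (i j k : ℝ) :
    ‖(i • triangularVec₁ 1 + j • triangularVec₂ 1 + k • layerNormal (2 * Real.sqrt (2 / 3)) : E3)‖ ^ 2
      = (i + j / 2) ^ 2 + 3 / 4 * j ^ 2 + 8 / 3 * k ^ 2 := by
  rw [EuclideanSpace.norm_eq, Real.sq_sqrt (by positivity), Fin.sum_univ_three]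
  simp only [Real.norm_eq_abs, sq_abs]
  obtain ⟨h0, h1, h2⟩ := lamVec_apply i j k
  rw [h0, h1, h2]
  nlinarith [Real.sq_sqrt (show (0 : ℝ) ≤ 3 by norm_num), sqrt23_sq]

/-- Separation of `Λ`: nonzero vectors have norm at least `1`. -/
theorem one_le_norm_of_mem_lam {z : E3} (hz : z ∈ Lam) (h0 : z ≠ 0) : 1 ≤ ‖z‖ := by
  obtain ⟨i, j, k, rfl⟩ := hz
  have hn := lam_norm_sq (i : ℝ) j k
  have hsq : 1 ≤ ‖((i : ℝ) • triangularVec₁ 1 + (j : ℝ) • triangularVec₂ 1 +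
      (k : ℝ) • layerNormal (2 * Real.sqrt (2 / 3)) : E3)‖ ^ 2 := by
    rw [hn]
    by_cases hk : k = 0
    · subst hk
      by_cases hj : j = 0
      · subst hj
        have hi : i ≠ 0 := by
          rintro rfl; exact h0 (by simp)
        have hi' : (1 : ℤ) ≤ i * i := by
          have h := Int.lt_iff_add_one_le.1 (mul_self_pos.2 hi)
          simpa using h
        have hi'' : (1 : ℝ) ≤ (i : ℝ) * i := by exact_mod_cast hi'
        push_cast; nlinarith
      · have hq : (1 : ℤ) ≤ i * i + i * j + j * j := by
          have hjj : 0 < j * j := mul_self_pos.2 hj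
          have h4 : 3 ≤ 4 * (i * i + i * j + j * j) := by nlinarith [sq_nonneg (2 * i + j)]
          generalize hq : i * i + i * j + j * j = q at h4
          omega
        have hq' : (1 : ℝ) ≤ (i : ℝ) * i + i * j + j * j := by exact_mod_cast hq
        push_cast; nlinarith
    · have hkk : (1 : ℤ) ≤ k * k := by
        have h := Int.lt_iff_add_one_le.1 (mul_self_pos.2 hk)
        simpa using h
      have hkk' : (1 : ℝ) ≤ (k : ℝ) * k := by exact_mod_cast hkk
      nlinarith [sq_nonneg ((i : ℝ) + j / 2), sq_nonneg (j : ℝ)]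
  nlinarith [norm_nonneg ((i : ℝ) • triangularVec₁ 1 + (j : ℝ) • triangularVec₂ 1 +
      (k : ℝ) • layerNormal (2 * Real.sqrt (2 / 3)) : E3)]

/-- Distinct lattice vectors are `≥ 1` apart. -/
theorem one_le_dist_of_mem_lam {z z' : E3} (hz : z ∈ Lam) (hz' : z' ∈ Lam) (h : z ≠ z') :
    1 ≤ dist z z' := by
  rw [dist_eq_norm]
  exact one_le_norm_of_mem_lam (lam_sub_mem hz hz') (sub_ne_zero.2 h)

/-- Covering: every point of `ℝ³` is within `11/10` of `Λ` (round the coordinates). -/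
theorem exists_lam_near (y : E3) : ∃ z ∈ Lam, ‖y - z‖ ≤ 11 / 10 := by
  set c₃ : ℝ := 2 * Real.sqrt (2 / 3) with hc₃
  set s : ℝ := Real.sqrt 3 / 2 with hs
  have hc₃pos : 0 < c₃ := by rw [hc₃]; positivity
  have hspos : 0 < s := by rw [hs]; positivity
  set k : ℤ := round (y 2 / c₃) with hk
  set j : ℤ := round (y 1 / s) with hj
  set i : ℤ := round (y 0 - j / 2) with hi
  refine ⟨_, mem_lam i j k, ?_⟩
  set z : E3 := (i : ℝ) • triangularVec₁ 1 + (j : ℝ) • triangularVec₂ 1 +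
      (k : ℝ) • layerNormal (2 * Real.sqrt (2 / 3)) with hz
  obtain ⟨h0, h1, h2⟩ := lamVec_apply (i : ℝ) j k
  have e0 : (y - z) 0 = (y 0 - j / 2) - i := by
    rw [PiLp.sub_apply, h0]; ring
  have e1 : (y - z) 1 = s * (y 1 / s - j) := by
    rw [PiLp.sub_apply, h1, hs]; field_simp
  have e2 : (y - z) 2 = c₃ * (y 2 / c₃ - k) := by
    rw [PiLp.sub_apply, h2, hc₃]; field_simp
  have b0 : |(y - z) 0| ≤ 1 / 2 := by rw [e0, hi]; exact abs_sub_round _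
  have b1 : |(y - z) 1| ≤ s * (1 / 2) := by
    rw [e1, abs_mul, abs_of_pos hspos]
    exact mul_le_mul_of_nonneg_left (by rw [hj]; exact abs_sub_round _) hspos.le
  have b2 : |(y - z) 2| ≤ c₃ * (1 / 2) := by
    rw [e2, abs_mul, abs_of_pos hc₃pos]
    exact mul_le_mul_of_nonneg_left (by rw [hk]; exact abs_sub_round _) hc₃pos.le
  have hss : s ^ 2 = 3 / 4 := by
    rw [hs, div_pow, Real.sq_sqrt (show (0 : ℝ) ≤ 3 by norm_num)]; norm_num
  have hcc : c₃ ^ 2 = 8 / 3 := by rw [hc₃, mul_pow, sqrt23_sq]; norm_num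
  have hsq : ‖y - z‖ ^ 2 ≤ 53 / 48 := by
    rw [EuclideanSpace.norm_eq, Real.sq_sqrt (by positivity), Fin.sum_univ_three]
    simp only [Real.norm_eq_abs, sq_abs]
    have a0 : (y - z) 0 ^ 2 ≤ (1 / 2) ^ 2 := sq_le_sq' (abs_le.1 b0).1 (abs_le.1 b0).2
    have a1 : (y - z) 1 ^ 2 ≤ (s * (1 / 2)) ^ 2 := sq_le_sq' (abs_le.1 b1).1 (abs_le.1 b1).2
    have a2 : (y - z) 2 ^ 2 ≤ (c₃ * (1 / 2)) ^ 2 := sq_le_sq' (abs_le.1 b2).1 (abs_le.1 b2).2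
    rw [mul_pow, hss] at a1
    rw [mul_pow, hcc] at a2
    linarith
  nlinarith [norm_nonneg (y - z)]

/-! ### Sites of an admissible datum: one within `11/10` of every point; `≥ 189/200` apart -/

/-- Covering radius of the sites of an admissible datum: every point of `ℝ³` is within `11/10` of a site `t₀ + A z`, `z ∈ Λ` (`A` is onto; round the preimage in `Λ`; `‖A‖ ≤ 199/200`). [folklore] -/
theorem exists_site_near {A : E3 →L[ℝ] E3} (hA : Adm A) (t₀ c : E3) :
    ∃ z ∈ Lam, dist (t₀ + A z) c ≤ 11 / 10 := by
  obtain ⟨y, hy⟩ := adm_surjective hA (c - t₀)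
  obtain ⟨z, hz, hyz⟩ := exists_lam_near y
  refine ⟨z, hz, ?_⟩
  have h : t₀ + A z - c = A (z - y) := by rw [map_sub, hy]; abel
  rw [dist_eq_norm, h]
  calc ‖A (z - y)‖ ≤ (199 / 200) * ‖z - y‖ := adm_norm_le hA _
    _ ≤ (199 / 200) * (11 / 10) := by rw [norm_sub_rev]; gcongr
    _ ≤ 11 / 10 := by norm_num

/-- `dist (t₀ + A z) (t₀ + A z') = ‖A (z − z')‖`. [folklore] -/
theorem dist_site_site {A : E3 →L[ℝ] E3} (t₀ z z' : E3) :
    dist (t₀ + A z) (t₀ + A z') = ‖A (z - z')‖ := by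
  rw [dist_eq_norm, map_sub]; congr 1; abel

/-- Distinct sites of one sublattice are `≥ 189/200` apart. [folklore] -/
theorem le_dist_site_of_ne {A : E3 →L[ℝ] E3} (hA : Adm A) (t₀ : E3) {z z' : E3}
    (hz : z ∈ Lam) (hz' : z' ∈ Lam) (h : z ≠ z') : 189 / 200 ≤ dist (t₀ + A z) (t₀ + A z') := by
  rw [dist_site_site]
  have h1 := adm_le_norm hA (z - z')
  have h2 := one_le_dist_of_mem_lam hz hz' h
  rw [dist_eq_norm] at h2
  linarith

/-- `4/5 ≤ √(2/3)`. [folklore] -/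
theorem four_fifths_le_sqrt23 : (4 : ℝ) / 5 ≤ Real.sqrt (2 / 3) := by
  nlinarith [sqrt23_sq, Real.sqrt_nonneg (2 / 3 : ℝ)]

/-- Sites on DIFFERENT sublattices are `≥ 7/10` apart: the height coordinate of
`w + √(2/3)e₃ + z' − z` (`z, z' ∈ Λ`) is an odd multiple of `√(2/3) ≥ 4/5`, `A` shrinks norms by at
most `189/200`, and `Inner` moves `t 1` off `t 0 + A(w + √(2/3)e₃)` by at most `1/40`. [folklore] -/
theorem le_dist_site_cross {A : E3 →L[ℝ] E3} (hA : Adm A) {t : Fin 2 → E3} (ht : Inner t A)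
    {z z' : E3} (hz : z ∈ Lam) (hz' : z' ∈ Lam) : 7 / 10 ≤ dist (t 1 + A z') (t 0 + A z) := by
  set off : E3 := barlowOffset 1 + layerNormal (Real.sqrt (2 / 3)) with hoff
  have hInner : ‖t 1 - t 0 - A off‖ ≤ 1 / 40 := ht
  have hdecomp : t 1 + A z' - (t 0 + A z) = (t 1 - t 0 - A off) + A (off + z' - z) := by
    simp only [map_add, map_sub]; abel
  have hv : (4 : ℝ) / 5 ≤ ‖off + z' - z‖ := by
    obtain ⟨i, j, k, rfl⟩ := hz
    obtain ⟨i', j', k', rfl⟩ := hz'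
    obtain ⟨-, -, h2⟩ := lamVec_apply (i : ℝ) j k
    obtain ⟨-, -, h2'⟩ := lamVec_apply (i' : ℝ) j' k'
    have hoff2 : off 2 = Real.sqrt (2 / 3) := by simp [hoff, barlowOffset, layerNormal]
    have e2 : (off + ((i' : ℝ) • triangularVec₁ 1 + (j' : ℝ) • triangularVec₂ 1 +
        (k' : ℝ) • layerNormal (2 * Real.sqrt (2 / 3))) - ((i : ℝ) • triangularVec₁ 1 +
        (j : ℝ) • triangularVec₂ 1 + (k : ℝ) • layerNormal (2 * Real.sqrt (2 / 3)))) 2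
        = Real.sqrt (2 / 3) * (2 * ((k' : ℝ) - k) + 1) := by
      rw [PiLp.sub_apply, PiLp.add_apply, h2, h2', hoff2]; ring
    have hk1 : (1 : ℝ) ≤ |(2 * ((k' : ℝ) - k) + 1)| := by
      have hk : (2 * (k' - k) + 1 : ℤ) ≠ 0 := by omega
      have : (1 : ℤ) ≤ |2 * (k' - k) + 1| := Int.one_le_abs hk
      exact_mod_cast this
    calc (4 : ℝ) / 5 ≤ |(off + ((i' : ℝ) • triangularVec₁ 1 + (j' : ℝ) • triangularVec₂ 1 +
        (k' : ℝ) • layerNormal (2 * Real.sqrt (2 / 3))) - ((i : ℝ) • triangularVec₁ 1 +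
        (j : ℝ) • triangularVec₂ 1 + (k : ℝ) • layerNormal (2 * Real.sqrt (2 / 3)))) 2| := by
          rw [e2, abs_mul, abs_of_nonneg (Real.sqrt_nonneg _)]
          nlinarith [Real.sqrt_nonneg (2 / 3 : ℝ), four_fifths_le_sqrt23]
      _ ≤ _ := abs_apply_le_norm _ 2
  have h1 : (189 / 200) * (4 / 5) ≤ ‖A (off + z' - z)‖ :=
    le_trans (by nlinarith) (adm_le_norm hA (off + z' - z))
  have h2 : ‖A (off + z' - z)‖ - ‖t 1 - t 0 - A off‖ ≤ ‖(t 1 - t 0 - A off) + A (off + z' - z)‖ := by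
    have := norm_sub_le ((t 1 - t 0 - A off) + A (off + z' - z)) (t 1 - t 0 - A off)
    rw [add_sub_cancel_left] at this
    linarith
  rw [dist_eq_norm, hdecomp]
  linarith

/-- Hence two sites within `1/40` of one point coincide (same sublattice index and same lattice
vector): the matching of `Near` never merges sites. [folklore] -/
theorem site_eq_of_dist_lt {A : E3 →L[ℝ] E3} (hA : Adm A) {t : Fin 2 → E3} (ht : Inner t A)
    {m m' : Fin 2} {z z' : E3} (hz : z ∈ Lam) (hz' : z' ∈ Lam) {p : E3}
    (hp : dist p (t m + A z) ≤ 1 / 40) (hp' : dist p (t m' + A z') ≤ 1 / 40) : m = m' ∧ z = z' := by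
  have hclose : dist (t m + A z) (t m' + A z') ≤ 1 / 20 := by
    calc dist (t m + A z) (t m' + A z') ≤ dist (t m + A z) p + dist p (t m' + A z') :=
          dist_triangle _ _ _
      _ ≤ 1 / 40 + 1 / 40 := by rw [dist_comm]; gcongr
      _ = 1 / 20 := by norm_num
  have hm : ∀ n : Fin 2, n = 0 ∨ n = 1 := by
    intro n
    rcases n with ⟨_ | _ | n, hn⟩
    · exact Or.inl rfl
    · exact Or.inr rfl
    · omega
  rcases hm m with hm0 | hm1 <;> rcases hm m' with hm0' | hm1'
  · refine ⟨by rw [hm0, hm0'], ?_⟩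
    by_contra hne
    have := le_dist_site_of_ne hA (t m) hz hz' hne
    rw [hm0] at this hclose; rw [hm0'] at hclose
    linarith
  · exfalso
    have := le_dist_site_cross hA ht hz hz'
    rw [hm0, hm1', dist_comm] at hclose
    linarith
  · exfalso
    have := le_dist_site_cross hA ht hz' hz
    rw [hm1, hm0'] at hclose
    linarith
  · refine ⟨by rw [hm1, hm1'], ?_⟩
    by_contra hne
    have := le_dist_site_of_ne hA (t m) hz hz' hne
    rw [hm1] at this hclose; rw [hm1'] at hclose
    linarith

/-! ### The crux unfolded over the named predicates (definitional) -/

/-- `CoarseGrains` is, definitionally, the displayed `∀ R ∃ N₀ ∀ N ∀ x` statement over `Adm`, `Inner`,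
`Near`. -/
theorem coarseGrains_iff :
    Theses.ExcessDecayLiouville.CoarseGrains ↔
    ∀ R : ℝ, 0 < R → ∃ N₀ : ℕ, ∀ N : ℕ, N₀ ≤ N → ∀ x : Fin N → E3,
      IsGroundState lennardJones x →
      ∃ (c : E3) (t : Fin 2 → E3) (A : E3 →L[ℝ] E3), Adm A ∧ Inner t A ∧
        Near (Set.range x) c R t A (1 / 40) :=
  Iff.rfl

end Summit.AtomisticToContinuum.Crystallization.Theorems.CoarseGrains.Negative.PredicateAPI

end
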